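import Literature.Barriers.Schanuel.AlgebraicIndependenceOfLogarithmsRoyKernels
import Literature.Barriers.Schanuel.AlgebraicIndependenceOfLogarithmsRoyThm2bis
import Literature.Barriers.Schanuel.AlgebraicIndependenceOfLogarithmsThm4FromThm2
import HarnessLib

/-!
# Barrier (Schanuel): Roy 1992, Theorem 2 proved from Theorem 1 (M. Waldschmidt)

Final companion on the layer **Theorem 1 ⇒ Theorem 2** of the chain behind the named fact
`Literature.Barriers.Schanuel.roy1992_strongSixExponentials` ([Roy1992] §4 Corollary 2):
`roy1992_thm2_of_thm1 : roy1992_thm1 → roy1992_thm2`, i.e. Roy's Theorem 2 (the named fact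
`roy1992_thm2` of `Literature.Barriers.Schanuel.AlgebraicIndependenceOfLogarithmsRoyThm12`)
deduced, exactly as printed in §§2–3, from M. Waldschmidt's Theorem 1 (`roy1992_thm1`,
[Waldschmidt1988, Thm 4.1] for `G_a^{d₀} × G_m^{d₁}` — the one transcendence input, which stays a
named fact). Together with `roy1992_strongSixExponentials_of_thm2`
(`Literature.Barriers.Schanuel.AlgebraicIndependenceOfLogarithmsThm4FromThm2`) this closes
`roy1992_thm1 → roy1992_thm2 → roy1992_thm4 → roy1992_cor1 → roy1992_strongSixExponentials`
(`roy1992_thm4_of_thm1`, `roy1992_strongSixExponentials_of_thm1`).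

Ingredients: Roy's category `𝒞` with Propositions 1–3 and Theorem 1bis
(`Literature.Barriers.Schanuel.AlgebraicIndependenceOfLogarithmsRoyCategory`,
`Literature.Barriers.Schanuel.AlgebraicIndependenceOfLogarithmsRoyKernels`), Theorem 3
(`Literature.Barriers.Schanuel.AlgebraicIndependenceOfLogarithmsRoyThm3`) and the abstract
Theorem 2bis (`Literature.Barriers.Schanuel.AlgebraicIndependenceOfLogarithmsRoyThm2bis`).

## What the source prints [Roy1992, §3, p. 32]

"Proof of Theorem 2bis. Consider the category `𝒞` and the functions `a, b, c, d, r` defined in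
Section 2. By Propositions 1 and 2, they fulfil the conditions of Theorem 3. Moreover, for this
choice of category and functions, Statement 1 is true since it is Theorem 1bis. Therefore all
statements contained in Theorem 3 are true for the same category and functions. In particular,
Statement 2′ is true." — followed by the deduction of Theorem 2bis (pp. 33–34), which is
Theorem 2 in the language of `𝒞` (§2, p. 27: "In this new formulation, Theorems 1 and 2 can be
expressed as follows").

## References

* [Roy1992] D. Roy, *Matrices whose coefficients are linear forms in logarithms*, J. Number
  Theory 41 (1992) 22–47: §1 Theorem 2 (p. 25); §2 Theorem 2bis (p. 27); §3 (pp. 32–34).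
* [Waldschmidt1988] M. Waldschmidt, *On the transcendence methods of Gel'fond and Schneider in
  several variables*, in: New Advances in Transcendence Theory (A. Baker ed.), Cambridge Univ.
  Press 1988, 375–398: Theorem 4.1.
-/

noncomputable section

namespace Literature.Barriers.Schanuel

open Module Submodule Complex Roy1992

/-- **Roy 1992, Theorem 2 from Theorem 1** (`roy1992_thm1 → roy1992_thm2`), following the printed
proof: in Roy's category `𝒞` (§2; `Roy1992.cat`, Propositions 1–3) Theorem 1 is Statement 1 of
Theorem 3 (`statement1_of_thm1`), so Theorem 3 gives Statement 2′ and Theorem 2bis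
(`Roy1992.AdmissibleCat.thm2bis`), which is Theorem 2 once the cokernels of `𝒞` are read as the
admissible maps `s`, the ratio `d₁(X')/b(X')` as `d₁'/(d₀' + d₁' − dim_K(s(V)))`, and the kernel
condition as `s(V) ∩ (ℚ̄^{d₀'} × 0) = 0` (`Obj.isThm2Minimal_iff`, `Obj.noBadKernel_iff`).
[cite: Roy1992, §1 Theorem 2 (p. 25); §2 Theorem 2bis (p. 27); §3 proof of Theorem 2bis (pp. 32–34)] -/
theorem roy1992_thm2_of_thm1 (h : roy1992_thm1) : roy1992_thm2 := by
  intro d₀ d₁ Y W V hfin hlog hrat hYV hWV hV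
  let X : Obj := ⟨d₀, d₁, Y, W, V, hfin, hlog, hrat, hYV, hWV⟩
  have hb : fb X ≠ 0 := (Obj.fb_ne_zero_iff X).2 hV
  obtain ⟨⟨X', ⟨⟨s, hs⟩, hb', hmin⟩, hno⟩, hall⟩ :=
    AdmissibleCat.thm2bis (𝒞 := cat) Obj.thm3Hyp Obj.fd₁_additive Obj.fa_le_fd₁ Obj.prop3
      (Obj.statement1_of_thm1 h) X hb
  refine ⟨⟨X'.d₀, X'.d₁, s, ?_, ?_⟩, ?_⟩
  · exact hs.isThm2Minimal_iff.2 ⟨hb', fun X'' s'' hs'' hb'' => hmin X'' ⟨s'', hs''⟩ hb''⟩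
  · have hV' : V.map s = X'.V := hs.2.2.2.symm
    rw [hV']
    refine (Obj.noBadKernel_iff X').1 ?_
    rintro ⟨A, i, hi, h1, h2, h3⟩
    exact hno ⟨A, ⟨i, hi⟩, h1, h2, h3⟩
  · intro d₀' d₁' s hmin htriv
    have hbr : IsBiRational s := hmin.1.2
    have hsc : X.IsCokerMap (X.mapObj s hbr) s := X.isCokerMap_mapObj hmin.1
    obtain ⟨hb', hmin'⟩ := hsc.isThm2Minimal_iff.1 hmin
    have hno : ¬ ∃ A, cat.IsKer A (X.mapObj s hbr) ∧ fd₁ A = 0 ∧ fb A = 0 ∧ fr A ≠ 0 := by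
      rintro ⟨A, ⟨i, hi⟩, h1, h2, h3⟩
      exact (Obj.noBadKernel_iff (X.mapObj s hbr)).2 htriv ⟨A, i, hi, h1, h2, h3⟩
    obtain ⟨hle1, hle2⟩ := hall (X.mapObj s hbr) ⟨s, hsc⟩ hb'
      (fun X'' ⟨s'', hs''⟩ hb'' => hmin' X'' s'' hs'' hb'') hno
    rw [← Obj.thm2Ratio_eq hsc] at hle1 hle2
    refine ⟨?_, ?_⟩
    · rw [Obj.cast_fb_add_fd] at hle1
      exact hle1
    · rw [Obj.cast_fa, Obj.cast_fb] at hle2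
      exact hle2

/-- **The whole chain below Theorem 1**: `roy1992_thm1 → roy1992_thm4` (Theorem 4 from
M. Waldschmidt's theorem, via Theorem 2). [cite: Roy1992, §4 Theorem 4 (p. 34)] -/
theorem roy1992_thm4_of_thm1 (h : roy1992_thm1) : roy1992_thm4 :=
  roy1992_thm4_of_thm2 (roy1992_thm2_of_thm1 h)

/-- **The strong six exponentials theorem from M. Waldschmidt's Theorem 1**:
`roy1992_thm1 → roy1992_strongSixExponentials` (Theorem 1 ⇒ Theorem 2 ⇒ Theorem 4 ⇒ Corollary 1 ⇒
Corollary 2, all steps proved in the tree). [cite: Roy1992, §4 Corollary 2 (p. 38)] -/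
theorem roy1992_strongSixExponentials_of_thm1 (h : roy1992_thm1) : roy1992_strongSixExponentials :=
  roy1992_strongSixExponentials_of_thm2 (roy1992_thm2_of_thm1 h)

end Literature.Barriers.Schanuel
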